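import Literature.NumberTheory.Sieve.HeathBrownCubicLemma45
import HarnessLib

/-!
# Heath-Brown's Lemma 11.1: `∑_{β̂_i ∈ 𝒞_i, D ∣ β̂₁ ∧ β̂₂} τ(β₁)² ≪ S₀⁶ D⁻² (log S₀)^{c(A)}`

File (two small definitions with bodies — the cross product and primitivity of integer 3-vectors — and
proofs; no named facts) in the decomposition of **Heath-Brown's Type II estimate, Lemma 3.10**
(`HeathBrown2001_lemma_3_10` of `HeathBrownCubicTypeII`), D. R. Heath-Brown, *Primes represented by
`x³ + 2y³`*, Acta Math. 186 (2001), 1–84, §11.  **Lemma 11.1** (p. 70): "Let `𝒞₁, 𝒞₂` be cubes of side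
`S₀`, not necessarily containing the origin. Suppose that `𝒞₁` and `𝒞₂` are included in a sphere, centred
on the origin, of radius `S₀^A` for some positive constant `A`. Then, if the vectors `β̂_i` are restricted
to be primitive, we will have `∑_{β̂_i ∈ 𝒞_i, D ∣ β̂₁ ∧ β̂₂} τ(β₁)² ≪ S₀⁶ D⁻² (log S₀)^{c(A)}` for some
constant `c(A)`, providing that `D ≪ S₀`."  Printed proof: "if `D ∣ β̂₁ ∧ β̂₂` then for each prime power
`p^e ∥ D` there is a corresponding integer `λ` … such that `β̂₂ ≡ λβ̂₁ (mod p^e)`. Here we use the fact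
that `p ∤ β̂₁`, since `β̂₁` is primitive. The Chinese Remainder Theorem then shows that `β̂₂ ≡ λβ̂₁ (mod D)`
for some integer `λ`. If `β̂₁` is given there are therefore at most `D` possible residue classes modulo `D`
in which `β̂₂` may lie. Since `D ≪ S₀` it follows that there are `O(S₀³D⁻²)` values of `β̂₂` corresponding
to each `β̂₁`. The sum in Lemma 11.1 is therefore `≪ S₀³D⁻² ∑_{β̂₁ ∈ 𝒞₁} τ(β₁)² ≪ S₀³D⁻² · S₀³(log S₀)^{c(A)}`
by Lemma 4.5."

Here `β̂₁ ∧ β̂₂` is the vector of `2 × 2` minors, i.e. the cross product (`cross3`), and the residue count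
`≤ D` is obtained without the Chinese Remainder Theorem from the triple-product identity
`x (c·b) − (c·x) b = ∑_j c_j (x b_j − x_j b)` with a Bézout vector `c`, `c·b = 1` (`exists_dot_eq_one`):
if `D ∣ b ∧ x` then `x ≡ (c·x) b (mod D)` (`modEq_smul_of_dvd_cross3`).  PROVED:

* `cross3`, `IsPrimitiveVec` (definitions with bodies), `exists_dot_eq_one` (Bézout for three integers),
  `cross3_add_smul` (periodicity), `modEq_smul_of_dvd_cross3`, **`card_cubeMod_filter_dvd_cross3_le`**
  (`#{x ∈ [0,D)³ : D ∣ b ∧ x} ≤ D` for primitive `b`), **`card_latticeCube_filter_dvd_cross3_le`**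
  (`#{β̂₂ ∈ 𝒞₂ : D ∣ β̂₁ ∧ β̂₂} ≤ D (S₀/D + 1)³`);
* **`HeathBrown2001_lemma_11_1`** — the lemma, with `D ≤ κS₀` for any `κ > 0` as the reading of
  "`D ≪ S₀`", `A ≥ 1` an integer, the sphere condition used only for `𝒞₁` (through Lemma 4.5), no
  primitivity restriction on `β̂₂` (a larger sum), and `c(A)` that of `HeathBrown2001_lemma_4_5`.

## References

* D. R. Heath-Brown, *Primes represented by `x³ + 2y³`*, Acta Math. 186 (2001), 1–84: Lemma 11.1 and
  its proof, p. 70; (11.4). [cite: HeathBrownActa2001, Lemma 11.1]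
* G. Harman, *Prime-Detecting Sieves* (2007), Lemma 13.22. [cite: Harman2007, Lemma 13.22]

## Mathlib / tree search

Mathlib: `Int.gcd_eq_gcd_ab` (Bézout), `Int.gcd_dvd_left/right`, `Int.emod_emod_of_dvd`; the cross
product `Matrix.crossProduct` on `Fin 3 → R` (`cross_cross_eq_smul_sub_smul'`) is not used — on
`ℤ × ℤ × ℤ` the one identity needed is checked by `ring`. Tree: `HeathBrownCubicLemma45`
(`HeathBrown2001_lemma_4_5`), `HeathBrownCubicLatticeCount` (`card_latticeCube_filter_le`, `cubeMod`,
`modVec`), `HeathBrownCubicTypeII` (`latticeCube`, `coordElt`).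
-/

noncomputable section

open Polynomial NumberField Finset

namespace Literature.NumberTheory.Sieve.CubicSieve

open LFunctions.CubeRootTwoField CubicPrimes

/-! ### Cross product and primitive vectors in `ℤ³` -/

/-- The cross product `β̂₁ ∧ β̂₂` of integer 3-vectors (the vector of `2 × 2` minors; (11.4):
`(v₁u₂ − u₁v₂, u₁w₂ − w₁u₂, w₁v₂ − v₁w₂)` up to the order and signs of the coordinates, which do not
affect divisibility by `D`). [cite: HeathBrownActa2001, §11 (11.4)] -/
def cross3 (b x : ℤ × ℤ × ℤ) : ℤ × ℤ × ℤ :=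
  (b.2.1 * x.2.2 - b.2.2 * x.2.1, b.2.2 * x.1 - b.1 * x.2.2, b.1 * x.2.1 - b.2.1 * x.1)

/-- "An integer vector is said to be 'primitive' if its coordinates have no non-trivial common factor"
(p. 25). [cite: HeathBrownActa2001, §4 p. 25] -/
def IsPrimitiveVec (b : ℤ × ℤ × ℤ) : Prop :=
  ∀ d : ℤ, d ∣ b.1 → d ∣ b.2.1 → d ∣ b.2.2 → IsUnit d

/-- `D` divides the vector `v` componentwise. [folklore] -/
def DvdVec (D : ℤ) (v : ℤ × ℤ × ℤ) : Prop := D ∣ v.1 ∧ D ∣ v.2.1 ∧ D ∣ v.2.2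

/-- Bézout for a primitive vector: there is `c ∈ ℤ³` with `c · b = 1`. [folklore] -/
theorem exists_dot_eq_one {b : ℤ × ℤ × ℤ} (hb : IsPrimitiveVec b) :
    ∃ c : ℤ × ℤ × ℤ, c.1 * b.1 + c.2.1 * b.2.1 + c.2.2 * b.2.2 = 1 := by
  set g₁ : ℕ := Int.gcd b.1 b.2.1 with hg₁
  set g : ℕ := Int.gcd (g₁ : ℤ) b.2.2 with hg
  have h1 : ((g₁ : ℕ) : ℤ) = b.1 * Int.gcdA b.1 b.2.1 + b.2.1 * Int.gcdB b.1 b.2.1 :=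
    Int.gcd_eq_gcd_ab _ _
  have h2 : ((g : ℕ) : ℤ) = (g₁ : ℤ) * Int.gcdA (g₁ : ℤ) b.2.2 + b.2.2 * Int.gcdB (g₁ : ℤ) b.2.2 :=
    Int.gcd_eq_gcd_ab _ _
  -- `g` divides all three coordinates, hence is a unit, hence `g = 1`
  have hg1 : (g : ℤ) ∣ b.1 := (Int.gcd_dvd_left (g₁ : ℤ) b.2.2).trans (Int.gcd_dvd_left b.1 b.2.1)
  have hg2 : (g : ℤ) ∣ b.2.1 := (Int.gcd_dvd_left (g₁ : ℤ) b.2.2).trans (Int.gcd_dvd_right b.1 b.2.1)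
  have hg3 : (g : ℤ) ∣ b.2.2 := Int.gcd_dvd_right (g₁ : ℤ) b.2.2
  have hunit : IsUnit (g : ℤ) := hb _ hg1 hg2 hg3
  have hgone : (g : ℤ) = 1 := by
    rcases Int.isUnit_iff.mp hunit with h | h
    · exact h
    · exfalso; have : (0 : ℤ) ≤ g := by positivity
      linarith
  refine ⟨(Int.gcdA b.1 b.2.1 * Int.gcdA (g₁ : ℤ) b.2.2, Int.gcdB b.1 b.2.1 * Int.gcdA (g₁ : ℤ) b.2.2,
    Int.gcdB (g₁ : ℤ) b.2.2), ?_⟩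
  simp only
  have h2' := h2
  rw [hgone] at h2'
  linear_combination -h2' - Int.gcdA (g₁ : ℤ) b.2.2 * h1

/-- The cross product is additive and `ℤ`-homogeneous in the second argument: periodicity modulo `D`.
[folklore] -/
theorem cross3_add_smul (b x t : ℤ × ℤ × ℤ) (D : ℤ) :
    cross3 b (x + D • t) = cross3 b x + D • cross3 b t := by
  ext <;> simp only [cross3, Prod.fst_add, Prod.snd_add, Prod.smul_fst, Prod.smul_snd, smul_eq_mul] <;>
    ring

/-- Divisibility of the cross product is `D`-periodic in the second argument. [folklore] -/
theorem dvdVec_cross3_add_smul_iff (b x t : ℤ × ℤ × ℤ) (D : ℤ) :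
    DvdVec D (cross3 b (x + D • t)) ↔ DvdVec D (cross3 b x) := by
  rw [cross3_add_smul]
  simp only [DvdVec, Prod.fst_add, Prod.snd_add, Prod.smul_fst, Prod.smul_snd, smul_eq_mul]
  constructor
  · rintro ⟨h1, h2, h3⟩
    exact ⟨(dvd_add_left (dvd_mul_right D _)).mp h1, (dvd_add_left (dvd_mul_right D _)).mp h2,
      (dvd_add_left (dvd_mul_right D _)).mp h3⟩
  · rintro ⟨h1, h2, h3⟩
    exact ⟨dvd_add h1 (dvd_mul_right D _), dvd_add h2 (dvd_mul_right D _),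
      dvd_add h3 (dvd_mul_right D _)⟩

/-- **The residue classes of `β̂₂` given `β̂₁`**: if `c · b = 1` and `D ∣ b ∧ x` then `x ≡ (c·x) b (mod D)`
componentwise (from the identity `x_i (c·b) − (c·x) b_i = ∑_j c_j (x_i b_j − x_j b_i)`).
[cite: HeathBrownActa2001, Lemma 11.1] -/
theorem modEq_smul_of_dvd_cross3 {b c x : ℤ × ℤ × ℤ} (hc : c.1 * b.1 + c.2.1 * b.2.1 + c.2.2 * b.2.2 = 1)
    {D : ℤ} (hD : DvdVec D (cross3 b x)) :
    DvdVec D (x - (c.1 * x.1 + c.2.1 * x.2.1 + c.2.2 * x.2.2) • b) := by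
  obtain ⟨h1, h2, h3⟩ := hD
  simp only [cross3] at h1 h2 h3
  set μ : ℤ := c.1 * x.1 + c.2.1 * x.2.1 + c.2.2 * x.2.2 with hμ
  refine ⟨?_, ?_, ?_⟩
  · have e : (x - μ • b).1 = -(c.2.1 * (b.1 * x.2.1 - b.2.1 * x.1)) + c.2.2 * (b.2.2 * x.1 - b.1 * x.2.2) := by
      simp only [Prod.fst_sub, Prod.smul_fst, smul_eq_mul, hμ]
      linear_combination (-x.1) * hc
    rw [e]
    exact dvd_add (dvd_neg.mpr (dvd_mul_of_dvd_right h3 _)) (dvd_mul_of_dvd_right h2 _)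
  · have e : (x - μ • b).2.1 = c.1 * (b.1 * x.2.1 - b.2.1 * x.1) + -(c.2.2 * (b.2.1 * x.2.2 - b.2.2 * x.2.1)) := by
      simp only [Prod.snd_sub, Prod.fst_sub, Prod.smul_snd, Prod.smul_fst, smul_eq_mul, hμ]
      linear_combination (-x.2.1) * hc
    rw [e]
    exact dvd_add (dvd_mul_of_dvd_right h3 _) (dvd_neg.mpr (dvd_mul_of_dvd_right h1 _))
  · have e : (x - μ • b).2.2 = -(c.1 * (b.2.2 * x.1 - b.1 * x.2.2)) + c.2.1 * (b.2.1 * x.2.2 - b.2.2 * x.2.1) := by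
      simp only [Prod.snd_sub, Prod.smul_snd, smul_eq_mul, hμ]
      linear_combination (-x.2.2) * hc
    rw [e]
    exact dvd_add (dvd_neg.mpr (dvd_mul_of_dvd_right h2 _)) (dvd_mul_of_dvd_right h1 _)

/-- Two reduced vectors `x, x' ∈ [0, D)³` that are congruent modulo `D` are equal. [folklore] -/
theorem eq_of_mem_cubeMod_of_dvdVec_sub {D : ℕ} {x x' : ℤ × ℤ × ℤ} (hx : x ∈ cubeMod D)
    (hx' : x' ∈ cubeMod D) (h : DvdVec (D : ℤ) (x - x')) : x = x' := by
  simp only [cubeMod, mem_product, mem_Ico] at hx hx'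
  obtain ⟨⟨a1, a1'⟩, ⟨a2, a2'⟩, ⟨a3, a3'⟩⟩ := hx
  obtain ⟨⟨b1, b1'⟩, ⟨b2, b2'⟩, ⟨b3, b3'⟩⟩ := hx'
  obtain ⟨h1, h2, h3⟩ := h
  simp only [Prod.fst_sub, Prod.snd_sub] at h1 h2 h3
  have key : ∀ u v : ℤ, 0 ≤ u → u < D → 0 ≤ v → v < D → (D : ℤ) ∣ u - v → u = v := by
    intro u v hu hu' hv hv' huv
    have := Int.emod_emod_of_dvd u (dvd_refl (D : ℤ))
    have e1 : u % D = u := Int.emod_eq_of_lt hu hu'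
    have e2 : v % D = v := Int.emod_eq_of_lt hv hv'
    have : u % D = v % D := (Int.ModEq.symm ((Int.modEq_iff_dvd).mpr (by
      have : (D : ℤ) ∣ -(u - v) := dvd_neg.mpr huv
      rwa [neg_sub] at this)))
    rw [e1, e2] at this
    exact this
  ext
  · exact key _ _ a1 a1' b1 b1' h1
  · exact key _ _ a2 a2' b2 b2' h2
  · exact key _ _ a3 a3' b3 b3' h3

open scoped Classical in
/-- **At most `D` residue classes**: for a primitive `b` and `D ≥ 1`,
`#{x ∈ [0, D)³ : D ∣ b ∧ x} ≤ D` ("if `β̂₁` is given there are therefore at most `D` possible residue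
classes modulo `D` in which `β̂₂` may lie"). [cite: HeathBrownActa2001, Lemma 11.1] -/
theorem card_cubeMod_filter_dvd_cross3_le {b : ℤ × ℤ × ℤ} (hb : IsPrimitiveVec b) {D : ℕ} (hD : 0 < D) :
    #((cubeMod D).filter (fun x => DvdVec (D : ℤ) (cross3 b x))) ≤ D := by
  obtain ⟨c, hc⟩ := exists_dot_eq_one hb
  have hD' : (0 : ℤ) < D := by exact_mod_cast hD
  -- `x ↦ (c·x) mod D` is injective on the set
  have htarget : #(Ico (0 : ℤ) D) = D := by simp
  refine le_trans ?_ htarget.le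
  refine card_le_card_of_injOn (fun x => (c.1 * x.1 + c.2.1 * x.2.1 + c.2.2 * x.2.2) % D) ?_ ?_
  · intro x _
    rw [mem_coe, mem_Ico]
    exact ⟨Int.emod_nonneg _ hD'.ne', Int.emod_lt_of_pos _ hD'⟩
  · intro x hx x' hx' h
    rw [mem_coe, mem_filter] at hx hx'
    simp only at h
    set μ := c.1 * x.1 + c.2.1 * x.2.1 + c.2.2 * x.2.2 with hμ
    set μ' := c.1 * x'.1 + c.2.1 * x'.2.1 + c.2.2 * x'.2.2 with hμ'
    have hm := modEq_smul_of_dvd_cross3 hc hx.2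
    have hm' := modEq_smul_of_dvd_cross3 hc hx'.2
    rw [← hμ] at hm
    rw [← hμ'] at hm'
    have hμμ : (D : ℤ) ∣ μ - μ' := Int.ModEq.dvd h.symm
    -- `x - x' = (x - μ b) - (x' - μ' b) + (μ - μ') b`
    refine eq_of_mem_cubeMod_of_dvdVec_sub hx.1 hx'.1 ?_
    obtain ⟨p1, p2, p3⟩ := hm
    obtain ⟨q1, q2, q3⟩ := hm'
    simp only [Prod.fst_sub, Prod.snd_sub, Prod.smul_fst, Prod.smul_snd, smul_eq_mul] at p1 p2 p3 q1 q2 q3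
    refine ⟨?_, ?_, ?_⟩ <;> simp only [Prod.fst_sub, Prod.snd_sub]
    · have e : x.1 - x'.1 = (x.1 - μ * b.1) - (x'.1 - μ' * b.1) + (μ - μ') * b.1 := by ring
      rw [e]; exact dvd_add (dvd_sub p1 q1) (dvd_mul_of_dvd_left hμμ _)
    · have e : x.2.1 - x'.2.1 = (x.2.1 - μ * b.2.1) - (x'.2.1 - μ' * b.2.1) + (μ - μ') * b.2.1 := by ring
      rw [e]; exact dvd_add (dvd_sub p2 q2) (dvd_mul_of_dvd_left hμμ _)
    · have e : x.2.2 - x'.2.2 = (x.2.2 - μ * b.2.2) - (x'.2.2 - μ' * b.2.2) + (μ - μ') * b.2.2 := by ring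
      rw [e]; exact dvd_add (dvd_sub p3 q3) (dvd_mul_of_dvd_left hμμ _)

open scoped Classical in
/-- **"`O(S₀³D⁻²)` values of `β̂₂` for each `β̂₁`"**: for a primitive `b`, `D ≥ 1` and a lattice cube of
side `S₀ ≥ 0`, `#{β̂₂ ∈ 𝒞₂ : D ∣ b ∧ β̂₂} ≤ D (S₀/D + 1)³`. [cite: HeathBrownActa2001, Lemma 11.1] -/
theorem card_latticeCube_filter_dvd_cross3_le {b : ℤ × ℤ × ℤ} (hb : IsPrimitiveVec b) {D : ℕ}
    (hD : 0 < D) (a : ℝ × ℝ × ℝ) {S₀ : ℝ} (hS : 0 ≤ S₀) :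
    (#((latticeCube a S₀).filter (fun x => DvdVec (D : ℤ) (cross3 b x))) : ℝ) ≤
      D * (S₀ / D + 1) ^ 3 := by
  have hbox := card_latticeCube_filter_le hD (fun x => DvdVec (D : ℤ) (cross3 b x))
    (fun x t => dvdVec_cross3_add_smul_iff b x t D) a hS
  refine hbox.trans ?_
  gcongr
  exact_mod_cast card_cubeMod_filter_dvd_cross3_le hb hD

/-! ### Lemma 11.1 -/

open scoped Classical in
/-- **Heath-Brown's Lemma 11.1** (p. 70; Harman's Lemma 13.22): "Let `𝒞₁, 𝒞₂` be cubes of side `S₀`, not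
necessarily containing the origin. Suppose that `𝒞₁` and `𝒞₂` are included in a sphere, centred on the
origin, of radius `S₀^A` … Then, if the vectors `β̂_i` are restricted to be primitive, we will have
`∑_{β̂_i ∈ 𝒞_i, D ∣ β̂₁ ∧ β̂₂} τ(β₁)² ≪ S₀⁶ D⁻² (log S₀)^{c(A)}` for some constant `c(A)`, providing that
`D ≪ S₀`."  Rendered for lattice cubes `latticeCube a_i S₀` with `S₀ ≥ 2`, the corner of `𝒞₁` bounded by
`S₀^A` (`A ≥ 1` an integer; the position of `𝒞₂` plays no role), `1 ≤ D ≤ κS₀` (any `κ > 0`),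
`τ(β₁) = idealDivisorCount ((coordElt β̂₁))`, primitivity imposed on `β̂₁` only (dropping it on `β̂₂`
enlarges the sum), and `c(A) = 2^{4(12A+62)+4} + 1` (that of `HeathBrown2001_lemma_4_5`).
[cite: HeathBrownActa2001, Lemma 11.1] [cite: Harman2007, Lemma 13.22] -/
theorem HeathBrown2001_lemma_11_1 {A : ℕ} (hA : 1 ≤ A) {κ : ℝ} (hκ : 0 < κ) :
    ∃ C : ℝ, 0 < C ∧ ∀ (a₁ a₂ : ℝ × ℝ × ℝ) (S₀ : ℝ), 2 ≤ S₀ →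
      |a₁.1| ≤ S₀ ^ A → |a₁.2.1| ≤ S₀ ^ A → |a₁.2.2| ≤ S₀ ^ A →
        ∀ D : ℕ, 1 ≤ D → (D : ℝ) ≤ κ * S₀ →
          ∑ b ∈ (latticeCube a₁ S₀).filter IsPrimitiveVec,
              ∑ _x ∈ (latticeCube a₂ S₀).filter (fun x => DvdVec (D : ℤ) (cross3 b x)),
                (idealDivisorCount (Ideal.span {coordElt b}) : ℝ) ^ 2 ≤
            C * S₀ ^ 6 / (D : ℝ) ^ 2 * Real.log S₀ ^ (2 ^ (4 * (12 * A + 62) + 4) + 1) := by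
  obtain ⟨C₅, hC₅, h45⟩ := HeathBrown2001_lemma_4_5 hA
  refine ⟨(1 + κ) ^ 3 * C₅, by positivity, ?_⟩
  intro a₁ a₂ S₀ hS₀ h1 h2 h3 D hD hDS
  have hS0 : 0 < S₀ := by linarith
  have hD0 : 0 < D := hD
  have hD' : (0 : ℝ) < D := by exact_mod_cast hD0
  set e := 2 ^ (4 * (12 * A + 62) + 4) + 1 with he
  -- the inner count, uniformly in `b`
  have hinner : ∀ b ∈ (latticeCube a₁ S₀).filter IsPrimitiveVec,
      ∑ _x ∈ (latticeCube a₂ S₀).filter (fun x => DvdVec (D : ℤ) (cross3 b x)),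
          (idealDivisorCount (Ideal.span {coordElt b}) : ℝ) ^ 2 ≤
        (idealDivisorCount (Ideal.span {coordElt b}) : ℝ) ^ 2 * ((1 + κ) ^ 3 * S₀ ^ 3 / (D : ℝ) ^ 2) := by
    intro b hb
    rw [mem_filter] at hb
    rw [sum_const, nsmul_eq_mul, mul_comm]
    refine mul_le_mul_of_nonneg_left ?_ (by positivity)
    refine (card_latticeCube_filter_dvd_cross3_le hb.2 hD0 a₂ hS0.le).trans ?_
    -- `D (S₀/D + 1)³ ≤ (1+κ)³ S₀³/D²` since `1 ≤ κ S₀/D`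
    have hk : S₀ / D + 1 ≤ (1 + κ) * (S₀ / D) := by
      have : 1 ≤ κ * (S₀ / D) := by
        rw [mul_div_assoc', le_div_iff₀ hD', one_mul]; exact hDS
      linarith
    calc (D : ℝ) * (S₀ / D + 1) ^ 3 ≤ D * ((1 + κ) * (S₀ / D)) ^ 3 := by gcongr
      _ = (1 + κ) ^ 3 * S₀ ^ 3 / (D : ℝ) ^ 2 := by field_simp
  calc ∑ b ∈ (latticeCube a₁ S₀).filter IsPrimitiveVec,
        ∑ _x ∈ (latticeCube a₂ S₀).filter (fun x => DvdVec (D : ℤ) (cross3 b x)),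
          (idealDivisorCount (Ideal.span {coordElt b}) : ℝ) ^ 2
      ≤ ∑ b ∈ (latticeCube a₁ S₀).filter IsPrimitiveVec,
          (idealDivisorCount (Ideal.span {coordElt b}) : ℝ) ^ 2 * ((1 + κ) ^ 3 * S₀ ^ 3 / (D : ℝ) ^ 2) :=
        sum_le_sum hinner
    _ = (∑ b ∈ (latticeCube a₁ S₀).filter IsPrimitiveVec,
          (idealDivisorCount (Ideal.span {coordElt b}) : ℝ) ^ 2) * ((1 + κ) ^ 3 * S₀ ^ 3 / (D : ℝ) ^ 2) := by
        rw [sum_mul]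
    _ ≤ (∑ b ∈ latticeCube a₁ S₀, (idealDivisorCount (Ideal.span {coordElt b}) : ℝ) ^ 2) *
          ((1 + κ) ^ 3 * S₀ ^ 3 / (D : ℝ) ^ 2) := by
        refine mul_le_mul_of_nonneg_right ?_ (by positivity)
        exact sum_le_sum_of_subset_of_nonneg (filter_subset _ _) fun b _ _ => by positivity
    _ ≤ (C₅ * S₀ ^ 3 * Real.log S₀ ^ e) * ((1 + κ) ^ 3 * S₀ ^ 3 / (D : ℝ) ^ 2) :=
        mul_le_mul_of_nonneg_right (h45 a₁ S₀ hS₀ h1 h2 h3) (by positivity)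
    _ = (1 + κ) ^ 3 * C₅ * S₀ ^ 6 / (D : ℝ) ^ 2 * Real.log S₀ ^ e := by
        field_simp

end Literature.NumberTheory.Sieve.CubicSieve

end
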